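import Literature.Probability.Percolation.IsoradialArmComparability
import Literature.Probability.Percolation.IsoradialArmUniversality
import HarnessLib

/-!
# Alternating `2j`-arm probabilities (`2j ≥ 4`) are comparable across isoradial graphs
(Grimmett–Manolescu 2014, Prop. 8.1, the cases not yet vendored; named fact)

Family `crit-ising` / CritPerc, layer `Literature/Probability/Percolation`. Companion of
`IsoradialArmComparability.lean`, whose named fact
`GrimmettManolescu2014_armComparability_one_two` is Prop. 8.1 for `k ∈ {1, 2}` (one arm; one
primal and one dual arm) on the tree's `embArmEvent`, and of `IsoradialArmUniversality.lean`,
whose `RhombicEmbedding.embAltArmEvent j r R` is the alternating `2j`-arm event in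
cluster-separated form (introduced there because `embArmEvent` does not impose the cyclic order of
the arms). THIS file vendors the remaining cases `k = 2j ≥ 4` of Prop. 8.1, on `embAltArmEvent`,
in exactly the shape of the sibling fact (same class hypotheses, same centring by "a primal or
dual vertex at the origin", same scope `N ≥ N₀`, `n ≥ c₀N`). Authoritative for `k = 1, 2`:
the sibling fact; for `k = 2j ≥ 4`: the fact below. Consumer: route
`Summits/CriticalPhenomena/…/Theses/CardyRetileGlue`, item `TransportOfGluing`
(`stmt-CriticalPhenomena-7033`): Schramm–Smirnov's Assumptions 1.1 (arXiv:1101.5820, (1.2) one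
arm, (1.3) the alternating FOUR-arm bound `Π⁴(z,r,R) ≤ (r/R)·Δ₄(r,R)`, uniformly in the centre)
are to be transferred from `ℤ²` to two-phase isoradial square lattices — (1.2) is the sibling's
`k = 1`, (1.3) is `j = 2` here.

Source read (2026-08-15): G. R. Grimmett, I. Manolescu, *Bond percolation on isoradial graphs:
criticality and universality*, Probab. Theory Relat. Fields 159 (2014) 273–327 = arXiv:1204.0505
(held), §8.1, verbatim: "We recall the isoradial embedding `G_{0,π/2}` of the homogeneous square
lattice, with associated measure denoted `ℙ_{0,π/2}`. **Proposition** [8.1, `exp_transport`].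
Let `k ∈ {1, 2, 4, …}`, `ε > 0`, and `I ∈ ℕ`. There exist constants `c_i = c_i(k, ε, I) > 0` and
`N₀ = N₀(k, ε, I) ∈ ℕ` such that, for `N ≥ N₀`, `n ≥ c₀N₀`, `G ∈ 𝒢(ε, I)`, and any vertex `u`
of `G^◇`, `c₁ ℙ_{0,π/2}[A_k(N, n)] ≤ ℙ_G[A_k^u(N, n)] ≤ c₂ ℙ_{0,π/2}[A_k(N, n)]`. Part (a) of
Theorem [Universality] is an immediate consequence" — and, same page: "We use the expression
'for `n > N` sufficiently large' to mean: for `n ≥ c₀N` and `N > N₀`." The formal scope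
`N ≥ N₀ ∧ c₀N ≤ n` follows this convention of the authors (it is the weaker reading of the
printed `n ≥ c₀N₀`), exactly as in the sibling file. §3: the arm-event `A_σ(N,n)` = "`k`
vertex-disjoint crossings of `𝒜(N,n) = [-n,n]² ∖ (-N,N)²` with colours `σ_i` taken in
anticlockwise order", `A_{2j}` for alternating `σ`; §8.2: the modified events `Ã_k` ("`x_i ↔ y_i`
and `x_i ↮ x_{i'}` for `i ≠ i'`") and Prop. 8.2 (`exp_equiv`), third display,
`c₃ ℙ_G[A_k] ≤ ℙ_G[Ã_k] ≤ c₄ ℙ_G[A_k]`.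

## Rendering, and what is (not) claimed

* Events: `emb.embAltArmEvent j N n` (`IsoradialArmUniversality`; sup-norm annulus with slack `2`,
  `j` open crossings pairwise not joined by an open path of the annulus and `j` dual-open
  crossings pairwise not joined by a dual-open path of the annulus). That this is GM's
  alternating event `A_{2j}(N,n)` up to the rendering rests on the informal planar-duality
  argument recorded in the docstring of `embAltArmEvent` together with Prop. 8.2; no proof of that
  identification is given here or there — the named fact below is stated for `embAltArmEvent` and
  its debt is recorded as such.
* Centring: as in the sibling fact, "centred at a vertex `u ∈ G^◇`" becomes the hypothesis that
  the origin is the position of a primal vertex or of a face centre; uniformity in `u` is the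
  uniformity of the constants over the class `𝒢(ε, I)`, which contains every translate of each
  of its members. The square-lattice side is `squareLatticeEmbedding` (`ℤ²`, vertex `0` at the
  origin, `squareLatticeEmbedding_z_zero`), whose canonical measure is `ℙ_{0,π/2}`.
* Class: `Preconnected ∧ IsIsoradial ∧ IsRhombicTiling ∧ HasBoundedAngles ε ∧
  SquareGridPropertyGM I` (the faithful SGP(I) of `IsoradialSquareGrid`), graphs over `Type`.
* Not here: `k ∈ {1, 2}` (sibling fact), exponents (`gm_universality_*`), any proof (XL:
  star–triangle transport, §§5–8).

## References

* [GrimmettManolescu2014Isoradial] G. R. Grimmett, I. Manolescu, Probab. Theory Relat. Fields 159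
  (2014) 273–327 = arXiv:1204.0505, §3 (arm events), §4.2 (SGP(I)), §8.1 Prop. 8.1
  (`exp_transport`), §8.2 Prop. 8.2 (`exp_equiv`) and the modified arm-events.
* [GrimmettManolescuAOP2013] G. R. Grimmett, I. Manolescu, Ann. Probab. 41 (2013) 2990–3025 (the
  inhomogeneous square/triangular/hexagonal case).
-/

noncomputable section

open MeasureTheory ProbabilityTheory

namespace Literature.Probability.Percolation

open LatticeModels Percolation

/-- NAMED FACT — **Grimmett–Manolescu 2014, Prop. 8.1 (`exp_transport`) with Prop. 8.2, for the
alternating events `k = 2j ≥ 4`** (the cases `k ∈ {1, 2}` being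
`GrimmettManolescu2014_armComparability_one_two`): "Let `k ∈ {1, 2, 4, …}`, `ε > 0`, and
`I ∈ ℕ`. There exist constants `c_i = c_i(k, ε, I) > 0` and `N₀ = N₀(k, ε, I) ∈ ℕ` such that, for
`N ≥ N₀`, `n ≥ c₀N₀`, `G ∈ 𝒢(ε, I)`, and any vertex `u` of `G^◇`,
`c₁ ℙ_{0,π/2}[A_k(N, n)] ≤ ℙ_G[A_k^u(N, n)] ≤ c₂ ℙ_{0,π/2}[A_k(N, n)]`" (scope rendered by the
authors' convention "`n ≥ c₀N` and `N > N₀`"). In the tree's rendering: for `ε > 0`, `I : ℕ` and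
`j ≥ 2` there are `c₁, c₂ > 0`, `c₀ ≥ 1` and `N₀` such that for every countable locally finite
preconnected graph on `Type`, isoradially and rhombically embedded with BAP(ε) and SGP(I)
(`SquareGridPropertyGM I`) and with a primal vertex or a face centre at the origin, and all
`N ≥ N₀`, `n ≥ c₀N`, the probability of the alternating `2j`-arm event `emb.embAltArmEvent j N n`
under the canonical measure lies within the factors `c₁, c₂` of that of `ℤ²`
(`squareLatticeEmbedding`). Users take `(h : GrimmettManolescu2014_altArmComparability)`.
[cite: GrimmettManolescu2014Isoradial, §8.1 Prop. 8.1 (exp_transport) and §8.2 Prop. 8.2, k = 2j ≥ 4; §3 (A_{2j})] -/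
def GrimmettManolescu2014_altArmComparability : Prop :=
  ∀ (ε : ℝ), 0 < ε → ∀ (I j : ℕ), 2 ≤ j → ∃ c₁ > (0 : ℝ), ∃ c₂ > (0 : ℝ), ∃ c₀ : ℕ, 1 ≤ c₀ ∧
    ∃ N₀ : ℕ, ∀ (V F : Type) [Countable V] [DecidableEq V] [DecidableEq F] (G : SimpleGraph V)
      [G.LocallyFinite] (emb : RhombicEmbedding G F),
      G.Preconnected → emb.IsIsoradial → emb.IsRhombicTiling → emb.HasBoundedAngles ε →
      emb.SquareGridPropertyGM I → ((∃ v : V, emb.z v = 0) ∨ (∃ f : F, emb.c f = 0)) →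
      ∀ N n : ℕ, N₀ ≤ N → c₀ * N ≤ n →
        c₁ * squareLatticeEmbedding.isoradialPercolation.real
            (squareLatticeEmbedding.embAltArmEvent j N n) ≤
          emb.isoradialPercolation.real (emb.embAltArmEvent j N n) ∧
        emb.isoradialPercolation.real (emb.embAltArmEvent j N n) ≤
          c₂ * squareLatticeEmbedding.isoradialPercolation.real
            (squareLatticeEmbedding.embAltArmEvent j N n)

namespace GrimmettManolescu2014_altArmComparability

/-- **Four arms** (`j = 2`: the alternating event behind Schramm–Smirnov's pivotal bound (1.3)),
projected from the fact. [cite: GrimmettManolescu2014Isoradial, §8.1 Prop. 8.1 (k = 4)] -/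
theorem fourArm (h : GrimmettManolescu2014_altArmComparability) {ε : ℝ} (hε : 0 < ε) (I : ℕ) :
    ∃ c₁ > (0 : ℝ), ∃ c₂ > (0 : ℝ), ∃ c₀ : ℕ, 1 ≤ c₀ ∧ ∃ N₀ : ℕ,
      ∀ (V F : Type) [Countable V] [DecidableEq V] [DecidableEq F] (G : SimpleGraph V)
        [G.LocallyFinite] (emb : RhombicEmbedding G F),
        G.Preconnected → emb.IsIsoradial → emb.IsRhombicTiling → emb.HasBoundedAngles ε →
        emb.SquareGridPropertyGM I → ((∃ v : V, emb.z v = 0) ∨ (∃ f : F, emb.c f = 0)) →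
        ∀ N n : ℕ, N₀ ≤ N → c₀ * N ≤ n →
          c₁ * squareLatticeEmbedding.isoradialPercolation.real
              (squareLatticeEmbedding.embAltArmEvent 2 N n) ≤
            emb.isoradialPercolation.real (emb.embAltArmEvent 2 N n) ∧
          emb.isoradialPercolation.real (emb.embAltArmEvent 2 N n) ≤
            c₂ * squareLatticeEmbedding.isoradialPercolation.real
              (squareLatticeEmbedding.embAltArmEvent 2 N n) :=
  h ε hε I 2 le_rfl

/-- **Comparability of two graphs of the class** (transitivity through `ℤ²`): for `G, G' ∈ 𝒢(ε, I)`
both with a diamond vertex at the origin and `j ≥ 2`,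
`ℙ_G[A_{2j}(N,n)] ≤ (c₂/c₁) ℙ_{G'}[A_{2j}(N,n)]` for `N ≥ N₀`, `n ≥ c₀N` — the form used at a
two-phase seam, and the mechanism by which Prop. 8.1 gives Theorem "Universality" (a).
[cite: GrimmettManolescu2014Isoradial, §8.1 (Prop. 8.1 ⟹ Thm. Universality (a))] -/
theorem le_of_mem_class (h : GrimmettManolescu2014_altArmComparability) {ε : ℝ} (hε : 0 < ε)
    (I : ℕ) {j : ℕ} (hj : 2 ≤ j) :
    ∃ C > (0 : ℝ), ∃ c₀ : ℕ, 1 ≤ c₀ ∧ ∃ N₀ : ℕ,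
      ∀ (V F : Type) [Countable V] [DecidableEq V] [DecidableEq F] (G : SimpleGraph V)
        [G.LocallyFinite] (emb : RhombicEmbedding G F)
        (V' F' : Type) [Countable V'] [DecidableEq V'] [DecidableEq F'] (G' : SimpleGraph V')
        [G'.LocallyFinite] (emb' : RhombicEmbedding G' F'),
        G.Preconnected → emb.IsIsoradial → emb.IsRhombicTiling → emb.HasBoundedAngles ε →
        emb.SquareGridPropertyGM I → ((∃ v : V, emb.z v = 0) ∨ (∃ f : F, emb.c f = 0)) →
        G'.Preconnected → emb'.IsIsoradial → emb'.IsRhombicTiling → emb'.HasBoundedAngles ε →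
        emb'.SquareGridPropertyGM I → ((∃ v : V', emb'.z v = 0) ∨ (∃ f : F', emb'.c f = 0)) →
        ∀ N n : ℕ, N₀ ≤ N → c₀ * N ≤ n →
          emb.isoradialPercolation.real (emb.embAltArmEvent j N n) ≤
            C * emb'.isoradialPercolation.real (emb'.embAltArmEvent j N n) := by
  obtain ⟨c₁, hc₁, c₂, hc₂, c₀, hc₀, N₀, H⟩ := h ε hε I j hj
  refine ⟨c₂ / c₁, by positivity, c₀, hc₀, N₀, ?_⟩
  intro V F _ _ _ G _ emb V' F' _ _ _ G' _ emb' hconn hiso hrh hbap hsgp h0 hconn' hiso' hrh' hbap'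
    hsgp' h0' N n hN hn
  obtain ⟨-, h2⟩ := H V F G emb hconn hiso hrh hbap hsgp h0 N n hN hn
  obtain ⟨h1', -⟩ := H V' F' G' emb' hconn' hiso' hrh' hbap' hsgp' h0' N n hN hn
  set P₀ := squareLatticeEmbedding.isoradialPercolation.real
    (squareLatticeEmbedding.embAltArmEvent j N n)
  -- `ℙ_G ≤ c₂ P₀` and `c₁ P₀ ≤ ℙ_{G'}` give `ℙ_G ≤ (c₂/c₁) ℙ_{G'}`
  have hP₀ : P₀ ≤ emb'.isoradialPercolation.real (emb'.embAltArmEvent j N n) / c₁ := by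
    rw [le_div_iff₀ hc₁, mul_comm]; exact h1'
  calc emb.isoradialPercolation.real (emb.embAltArmEvent j N n)
      ≤ c₂ * P₀ := h2
    _ ≤ c₂ * (emb'.isoradialPercolation.real (emb'.embAltArmEvent j N n) / c₁) :=
        mul_le_mul_of_nonneg_left hP₀ hc₂.le
    _ = c₂ / c₁ * emb'.isoradialPercolation.real (emb'.embAltArmEvent j N n) := by ring

end GrimmettManolescu2014_altArmComparability

end Literature.Probability.Percolation

end
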